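import Literature.MathematicalPhysics.QuantumFieldTheory.King1986.SingleScaleRate

/-!
# BalabanUVNodes ∕ N15 — THE KING-MODEL RUNG, CURVED EDITION (PART F₀): THE (4.42)–(4.43) ASSEMBLY ENGINE FOR TWO LEGS AGAINST A KERNEL —
# selector matrices turning King's double sum `Σ_w (Σ_z f(z)C(z, w))g(w)` into a product of square matrices, so that the tree's abstract
# three-replacement bound `King1986.prod3_rate` ((4.43)) applies; generic finite-index algebra, no King object
# (Track A, DAG node N15 = NE2; FAN-OUT v1.1 §N15 s3 «KING-MODEL RUNG»; used by part F `…N15KingModelSlicesTorus`)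

HONEST FRAMING.  Count-neutral [folklore] bookkeeping (cell `pub-ymgap`, seat `pub-ymgap-dag-n15-e` g4; `--supports stmt-QuantumFields-19908 --as
helper` = K3′ `SpineGivenEndpointR12`, lineage K3 19676).  Nothing of King's or Bałaban's is asserted: the one cited input is the tree's
PROVED abstract (4.43) `King1986.prod3_rate` (square matrices on one finite index set with a pseudo-distance).  King's (4.42) p. 675 pairs
TWO LEGS (the outer factors `a_jG_jQ^*_j(x, ·)`, `a_jG_jQ^*_j(y, ·)`, functions on the scale-`j` lattice `U` for fixed fine points `x, y`)
against the kernel `C^{(j)}` on `U`: *"G^{η′}_{(j)}(x′, y′) = a²_{j+n}(L^jη)^{−4} Σ_{z,w∈L^jηZ^d} (L^jη)^{2d}G^{η′}_{j+n}Q*_{j+n}(x′, z)·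
C^{(j+n),L^jη}(z, w)Q_{j+n}G^{η′}_{j+n}(w, y′). (4.42)"*.  THIS FILE: `triple f C g = Σ_w (Σ_z f(z)C(z, w))·g(w)`; the selector matrices
`rowSel f u₀` ∕ `colSel g v₀` (the leg in one row ∕ column, zero elsewhere) with `triple f C g = (rowSel f u₀ · C · colSel g v₀)(u₀, v₀)`
(`triple_eq_selectors`); decay bounds of a leg measured from `u₀` pass to the selector (`abs_rowSel_le`, `abs_colSel_le`; the zero rows are
free); selectors of differences (`rowSel_sub`, `colSel_sub`); and **`triple_rate`**: `prod3_rate`'s three-replacement bound for the triple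
contraction at two spacings — `|Σ(Σ f′C′)g′ − Σ(Σ fC)g| ≤ (εA·c·β + α·εC·β + α·c·εB)·V²·e^{−(κ∕2)d(u₀, v₀)}`; one scalar used downstream
(`inv_pow_le_rate_pow`: `L^{−j} ≤ (L^{−γ∕2})^j`).  0 `sorry`, standard axioms; nothing continuum ∕ ℝ⁴ ∕ OS ∕ mass-gap ∕ Clay.
Locators: [King1986] C. King, CMP **102** (1986) 649–677: (4.42)–(4.43) p. 675.
-/

noncomputable section

namespace Summit.QuantumFields.YangMills.BalabanUVNodes.N15KingModelRung.Curved

open Real Finset Matrix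
open Literature.MathematicalPhysics.QuantumFieldTheory.King1986 (prod3_rate)

/-! ## §1 The triple contraction and the selector matrices -/

/-- The triple contraction `Σ_w (Σ_z f(z)C(z, w))·g(w)` of two legs against a kernel on `U`. [cite: King1986, (4.42) p.675 (shape)] -/
def triple {U : Type*} [Fintype U] (f : U → ℝ) (C : Matrix U U ℝ) (g : U → ℝ) : ℝ := ∑ w, (∑ z, f z * C z w) * g w

/-- The row selector: the leg `f` placed in row `u₀` of a square matrix on `U` (other rows zero). [folklore] -/
def rowSel {U : Type*} [DecidableEq U] (f : U → ℝ) (u₀ : U) : Matrix U U ℝ := Matrix.of fun u z => if u = u₀ then f z else 0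

/-- The column selector: the leg `g` placed in column `v₀`. [folklore] -/
def colSel {U : Type*} [DecidableEq U] (g : U → ℝ) (v₀ : U) : Matrix U U ℝ := Matrix.of fun w v => if v = v₀ then g w else 0

/-- The triple contraction is the `(u₀, v₀)` entry of the selector product `rowSel f u₀ · C · colSel g v₀`. [folklore] -/
theorem triple_eq_selectors {U : Type*} [Fintype U] [DecidableEq U] (f : U → ℝ) (C : Matrix U U ℝ) (g : U → ℝ) (u₀ v₀ : U) :
    triple f C g = (rowSel f u₀ * C * colSel g v₀) u₀ v₀ := by
  simp only [triple, rowSel, colSel, Matrix.mul_apply, Matrix.of_apply, if_true]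

/-- A selector's entries inherit any decay bound of its leg measured from the selected row (the other rows are `0`). [folklore] -/
theorem abs_rowSel_le {U : Type*} [DecidableEq U] {f : U → ℝ} {u₀ : U} {dist : U → U → ℝ} {c κ : ℝ} (hc : 0 ≤ c)
    (hf : ∀ z, |f z| ≤ c * Real.exp (-(κ * dist u₀ z))) (u z : U) :
    |rowSel f u₀ u z| ≤ c * Real.exp (-(κ * dist u z)) := by
  simp only [rowSel, Matrix.of_apply]
  split_ifs with h
  · subst h; exact hf z
  · rw [abs_zero]; positivity

/-- The same for the column selector (decay measured to the selected column). [folklore] -/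
theorem abs_colSel_le {U : Type*} [DecidableEq U] {g : U → ℝ} {v₀ : U} {dist : U → U → ℝ} {c κ : ℝ} (hc : 0 ≤ c)
    (hg : ∀ w, |g w| ≤ c * Real.exp (-(κ * dist w v₀))) (w v : U) :
    |colSel g v₀ w v| ≤ c * Real.exp (-(κ * dist w v)) := by
  simp only [colSel, Matrix.of_apply]
  split_ifs with h
  · subst h; exact hg w
  · rw [abs_zero]; positivity

/-- Differences of selectors are selectors of differences. [folklore] -/
theorem rowSel_sub {U : Type*} [DecidableEq U] (f f' : U → ℝ) (u₀ : U) :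
    rowSel f' u₀ - rowSel f u₀ = rowSel (fun z => f' z - f z) u₀ := by
  ext u z
  simp only [rowSel, Matrix.sub_apply, Matrix.of_apply]
  split_ifs <;> simp

/-- Differences of column selectors. [folklore] -/
theorem colSel_sub {U : Type*} [DecidableEq U] (g g' : U → ℝ) (v₀ : U) :
    colSel g' v₀ - colSel g v₀ = colSel (fun w => g' w - g w) v₀ := by
  ext w v
  simp only [colSel, Matrix.sub_apply, Matrix.of_apply]
  split_ifs <;> simp

/-- **THE THREE REPLACEMENTS OF (4.43), ABSTRACTLY, FOR TWO LEGS AGAINST A KERNEL** (`King1986.prod3_rate` on the selector matrices): on a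
finite index set with a pseudo-distance, legs `f, g` (and their primed versions) decaying from ∕ to the points `u₀, v₀`, kernels `C, C′`
decaying, the three differences carrying `εA, εC, εB`, and the lattice sum `Σ_z e^{−(κ∕2)d(u,z)} ≤ V`:
`|Σ_w(Σ_z f′C′)g′ − Σ_w(Σ_z fC)g| ≤ (εA·c·β + α·εC·β + α·c·εB)·V²·e^{−(κ∕2)d(u₀,v₀)}`. [cite: King1986, (4.42)–(4.43) p.675] [folklore] -/
theorem triple_rate {U : Type*} [Fintype U] [DecidableEq U] (dist : U → U → ℝ) (hd0 : ∀ u v, 0 ≤ dist u v)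
    (htri : ∀ u v w, dist u w ≤ dist u v + dist v w) {f f' g g' : U → ℝ} {C C' : Matrix U U ℝ} {u₀ v₀ : U}
    {κ α c β εA εC εB V : ℝ} (hκ : 0 ≤ κ) (hα : 0 ≤ α) (hεA : 0 ≤ εA) (hc : 0 ≤ c) (hεC : 0 ≤ εC) (hβ : 0 ≤ β) (hεB : 0 ≤ εB)
    (hf : ∀ z, |f z| ≤ α * Real.exp (-(κ * dist u₀ z)))
    (hC : ∀ z w, |C z w| ≤ c * Real.exp (-(κ * dist z w)))
    (hC' : ∀ z w, |C' z w| ≤ c * Real.exp (-(κ * dist z w)))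
    (hg' : ∀ w, |g' w| ≤ β * Real.exp (-(κ * dist w v₀)))
    (hdf : ∀ z, |f' z - f z| ≤ εA * Real.exp (-(κ * dist u₀ z)))
    (hdC : ∀ z w, |C' z w - C z w| ≤ εC * Real.exp (-(κ * dist z w)))
    (hdg : ∀ w, |g' w - g w| ≤ εB * Real.exp (-(κ * dist w v₀)))
    (hV : ∀ u, ∑ z, Real.exp (-(κ / 2 * dist u z)) ≤ V) :
    |triple f' C' g' - triple f C g| ≤ (εA * c * β + α * εC * β + α * c * εB) * V ^ 2 * Real.exp (-(κ / 2 * dist u₀ v₀)) := by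
  have h := prod3_rate dist hd0 htri (rowSel f u₀) (rowSel f' u₀) C C' (colSel g v₀) (colSel g' v₀) hκ hα hεA hc hεC
    (abs_rowSel_le hα hf) hC hC' (abs_colSel_le hβ hg')
    (fun u z => by rw [rowSel_sub]; exact abs_rowSel_le hεA hdf u z)
    (fun z w => by rw [Matrix.sub_apply]; exact hdC z w)
    (fun w v => by rw [colSel_sub]; exact abs_colSel_le hεB hdg w v) hV u₀ v₀
  rwa [Matrix.sub_apply, ← triple_eq_selectors, ← triple_eq_selectors] at h

/-! ## §2 A scalar -/

/-- `L^{−j} ≤ (L^{−γ∕2})^j` for `L ≥ 1`, `γ ≤ 2`. [folklore] -/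
theorem inv_pow_le_rate_pow {L : ℕ} (hL : 1 ≤ L) {γ : ℝ} (hγ : γ ≤ 2) (j : ℕ) :
    ((L : ℝ) ^ j)⁻¹ ≤ ((L : ℝ) ^ (-(γ / 2))) ^ j := by
  have hL' : (1 : ℝ) ≤ L := by exact_mod_cast hL
  have hL0 : (0 : ℝ) < L := by linarith
  rw [← inv_pow, ← Real.rpow_neg_one]
  exact pow_le_pow_left₀ (Real.rpow_nonneg hL0.le _) (Real.rpow_le_rpow_of_exponent_le hL' (by linarith)) j

end Summit.QuantumFields.YangMills.BalabanUVNodes.N15KingModelRung.Curved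

end
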